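import Mathlib
import HarnessLib.Audit
import Summits.PneNP.PneNP.Theorems.PstarCrossRegime
import Summits.PneNP.PneNP.Theorems.PstarCrossLink

/-!
# The blind free CROSS gate: the residual NODES of the virtual-chord line and their COVERAGE (O2 / E1; prover-1 g22)

FRONTIER range-avoidance ladder, rung F-N3 (`stmt-PneNP-19007`), cell `pnp-ideate`; restricted-model proof complexity — nothing here bears on `P` versus `NP`.

Cross data `B` (`PstarCrossData.CrossData I r B e_p e_q g₀`; from the raw E1 datum by `PstarCrossData.crossData_of_terminal`, all orientations by
`PstarCrossLink`), virtual system `V = (sys I B).vsys e_p e_q` on `N₁ = N.erase e_q` (`PstarCrossSystem`: infeasible, chord-minimal in every chord, constant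
reads, the virtual chord `e_p` reads `(1,0)` with prescribed product `u_p ∨ u_q`; `PstarCrossRegime`: `u_p ∨ u_q = 1` at every admissible virtual state
meeting the second target, the (M0) witnesses of `e_p`/`e_q` at base points with `(u_p,u_q) = (1,0)`/`(0,1)`, every chord read, corner forcing, and the
REGIME TRICHOTOMY).  Write `E := (N.erase e_q).erase e_p` for the real chords other than the two gate chords.  The four residual nodes (each
`CrossData ⟹ … ⟹ #J₀ ≤ 5`; typed by this seat in the format of the planner's `PstarGateNodes` for E2):

* N1 `CrossCasePEmpty` — `E = ∅`: the core is the forest plus the two gate chords; the virtual system is single-read, `Z(q) ⊆ {u_p ∨ u_q = 1}` for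
  `q = F₂ + t₂`, `F₁ ≡ t₁` on `Z(q)`, both facets `u_p = 0`, `u_q = 0` met on `Z(q)` — the pure COUPLING-CLASSIFICATION problem (planner memo §14.42–§14.47,
  `PstarLemmaAlpha`), plus the tree-edge releases and the budget `#(J₀ ∖ N) + 3 ≤ 2 + 2·#Pv` (`PstarCrossBudget`).
* N2 `CrossCasePChords` — `E ≠ ∅` and the virtual system single-read (regime P): additionally every `e ∈ E` is forced ON on `Z(q)` ((★★)), so the landed
  per-chord forcing (`PstarForcing.forced_chord_cases` on `V`: (EQ)/(EXC)/(NOR) w.r.t. `q`) applies to every real chord of `E`.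
* N3 `CrossCaseT` — regime T: `E ≠ ∅`, all of `E` read along ONE `m ∈ {(0,1), (1,1)}`, each `e ∈ E` CORNER-FORCED (`u_p = u_q = 0 ⟹ u_e = 1`).
* N4 `CrossU2` — `E = {e₀}` read by both constraints independently, corner-forced.
PROVED here: **`crossCount_of_nodes : N1 → N2 → N3 → N4 → CrossCount`** (`PstarCrossRegime.regime_trichotomy`) and
**`cross1BlindOr_of_nodes : N1 → N2 → N3 → N4 → TerminalFiveCross1BlindOr`** (with `PstarCrossLink.cross1BlindOr_of_crossCount`).
Census support (planner p3, K22/K25, memo §14.39–§14.40, §14.44): no admissible cross datum with the gate footprint at `#J₀ ∈ {5, 6, 7}`.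
-/

set_option linter.dupNamespace false -- `Summit.PneNP.PneNP.…`: summit = sub-problem name (D-0017 single-conjunct layout)

open Finset Literature.Computability.Complexity
open Summit.PneNP.PneNP.Theorems.PstarTyped (Typed)
open Summit.PneNP.PneNP.Theorems.PstarSALevel (BoundaryExpanding SimpleOverlap)
open Summit.PneNP.PneNP.Theorems.PstarReadSumset (V2)
open Summit.PneNP.PneNP.Theorems.PstarChordSystem (ChordSystem)
open Summit.PneNP.PneNP.Theorems.PstarChordBridge (BridgeData sys)
open Summit.PneNP.PneNP.Theorems.PstarCrossBlind (TerminalFiveCross1BlindOr)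
open Summit.PneNP.PneNP.Theorems.PstarCrossData (CrossData CrossCount)
open Summit.PneNP.PneNP.Theorems.PstarCrossLink (cross1BlindOr_of_crossCount)
open Summit.PneNP.PneNP.Theorems.PstarCrossRegime (regime_trichotomy)

namespace Summit.PneNP.PneNP.Theorems.PstarCrossNodes

variable {n m : ℕ}

/-- **N1 `CrossCasePEmpty`** — no real chord besides the two gate chords (`(N.erase e_q).erase e_p = ∅`): the pure coupling-classification node.  OPEN. -/
@[conjecture] def CrossCasePEmpty : Prop :=
  ∀ (n m r : ℕ) (I : LocalMap 4 n m), I.IsPure xorAndPred → Typed I → SimpleOverlap I → BoundaryExpanding r I →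
  ∀ (B : BridgeData n m) (e_p e_q g₀ : Fin m), CrossData I r B e_p e_q g₀ → (B.N.erase e_q).erase e_p = ∅ → B.J₀.card ≤ 5

/-- **N2 `CrossCasePChords`** — regime P with a real chord besides the gate chords: the virtual system is single-read.  OPEN. -/
@[conjecture] def CrossCasePChords : Prop :=
  ∀ (n m r : ℕ) (I : LocalMap 4 n m), I.IsPure xorAndPred → Typed I → SimpleOverlap I → BoundaryExpanding r I →
  ∀ (B : BridgeData n m) (e_p e_q g₀ : Fin m), CrossData I r B e_p e_q g₀ → ((B.N.erase e_q).erase e_p).Nonempty →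
    ((sys I B).vsys e_p e_q).SingleRead → B.J₀.card ≤ 5

/-- **N3 `CrossCaseT`** — regime T: the real chords besides the gate chords form a non-empty family read along ONE direction `m ∈ {(0,1), (1,1)}`, all
read, each corner-forced (`u_p = u_q = 0 ⟹ u_e = 1`).  OPEN. -/
@[conjecture] def CrossCaseT : Prop :=
  ∀ (n m r : ℕ) (I : LocalMap 4 n m), I.IsPure xorAndPred → Typed I → SimpleOverlap I → BoundaryExpanding r I →
  ∀ (B : BridgeData n m) (e_p e_q g₀ : Fin m), CrossData I r B e_p e_q g₀ → ((B.N.erase e_q).erase e_p).Nonempty →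
    ∀ mv : V2, (mv = (0, 1) ∨ mv = (1, 1)) →
    (∀ e ∈ (B.N.erase e_q).erase e_p,
      (((sys I B).vsys e_p e_q).ρ e 0 = 0 ∨ ((sys I B).vsys e_p e_q).ρ e 0 = mv) ∧
      (((sys I B).vsys e_p e_q).ρ' e 0 = 0 ∨ ((sys I B).vsys e_p e_q).ρ' e 0 = mv)) →
    (∀ e ∈ (B.N.erase e_q).erase e_p, ((sys I B).vsys e_p e_q).ρ e 0 ≠ 0 ∨ ((sys I B).vsys e_p e_q).ρ' e 0 ≠ 0) →
    (∀ e ∈ (B.N.erase e_q).erase e_p, ∀ a, (sys I B).u e_p a = 0 → (sys I B).u e_q a = 0 → (sys I B).u e a = 1) →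
    B.J₀.card ≤ 5

/-- **N4 `CrossU2`** — one real chord `e₀` besides the gate chords, read by both constraints independently, corner-forced.  OPEN. -/
@[conjecture] def CrossU2 : Prop :=
  ∀ (n m r : ℕ) (I : LocalMap 4 n m), I.IsPure xorAndPred → Typed I → SimpleOverlap I → BoundaryExpanding r I →
  ∀ (B : BridgeData n m) (e_p e_q g₀ : Fin m), CrossData I r B e_p e_q g₀ →
    ∀ e₀ : Fin m, (B.N.erase e_q).erase e_p = {e₀} →
    ((sys I B).vsys e_p e_q).ρ e₀ 0 ≠ 0 → ((sys I B).vsys e_p e_q).ρ' e₀ 0 ≠ 0 → ((sys I B).vsys e_p e_q).ρ e₀ 0 ≠ ((sys I B).vsys e_p e_q).ρ' e₀ 0 →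
    (∀ a, (sys I B).u e_p a = 0 → (sys I B).u e_q a = 0 → (sys I B).u e₀ a = 1) →
    B.J₀.card ≤ 5

/-- **COVERAGE: the four nodes exhaust cross data** (`PstarCrossRegime.regime_trichotomy`). -/
theorem crossCount_of_nodes (h₁ : CrossCasePEmpty) (h₂ : CrossCasePChords) (h₃ : CrossCaseT) (h₄ : CrossU2) : CrossCount := by
  intro n m r I hI hT hS hB B e_p e_q g₀ hD
  rcases regime_trichotomy I hI hT hS hB hD with ⟨hsr, -⟩ | ⟨hne, mv, hmv, hline, hread, hcorner⟩ | ⟨e₀, hE, h1, h2, h3, hcorner⟩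
  · by_cases hE : (B.N.erase e_q).erase e_p = ∅
    · exact h₁ n m r I hI hT hS hB B e_p e_q g₀ hD hE
    · exact h₂ n m r I hI hT hS hB B e_p e_q g₀ hD (nonempty_iff_ne_empty.2 hE) hsr
  · exact h₃ n m r I hI hT hS hB B e_p e_q g₀ hD hne mv hmv hline hread hcorner
  · exact h₄ n m r I hI hT hS hB B e_p e_q g₀ hD e₀ hE h1 h2 h3 hcorner

/-- **So the E1 residue of O2 is the four nodes**: `N1 → N2 → N3 → N4 → TerminalFiveCross1BlindOr`. -/
theorem cross1BlindOr_of_nodes (h₁ : CrossCasePEmpty) (h₂ : CrossCasePChords) (h₃ : CrossCaseT) (h₄ : CrossU2) : TerminalFiveCross1BlindOr :=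
  cross1BlindOr_of_crossCount (crossCount_of_nodes h₁ h₂ h₃ h₄)

end Summit.PneNP.PneNP.Theorems.PstarCrossNodes
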